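/-
Copyright: statement-level skeleton of a published paper (lit-balaban cell, Phase-2 proof seat p10, gen 4). No proof claims
beyond what the kernel checks below.
-/
import Mathlib
import Literature.MathematicalPhysics.QuantumFieldTheory.BalabanImbrieJaffe1984to88.BIJ85SigmaClosedCubeZero

/-!
# `BalabanImbrieJaffe1984to88.BIJ85Thm711ClosedCube` — T. Bałaban, J. Imbrie, A. Jaffe, *Renormalization of the Higgs model:
minimizers, propagators and the stability of mean field theory*, Commun. Math. Phys. **97** (1985) 299–329
[BalabanImbrieJaffe1985]: Sect. 7.1 pp. 321–325 — **Theorem 7.1.1 in the fibrewise form (7.1.22) on the CLOSED momentum cube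
|p_j| ≤ π** (momenta with vanishing components and the fibre p′ = 0 included), for the symbols (7.1.7)–(7.1.16) with their removable
singularities filled (file 3/3; file 1/3 `BIJ85SigmaClosedCube` = the corrected symbols `sigmaC` and the full citation header, file 2/3
`BIJ85SigmaClosedCubeZero` = nonnegativity of the l-terms and the fibre p′ = 0)

statement-level skeleton of published theorems with citation tags; proofs where landed; nothing here is a claim about
the Yang–Mills mass gap

PDF held: `paper:balaban1985-cmp97-bij-higgs-minimizers` (journal page = PDF page + 298); pp. 321–325 (PDF 23–27).

CITATION HEADER (lean-in-tree rule).  Part of the lit-balaban TYPED SKELETON (HOME `run/shared/lean/pub/lit-balaban/`); WHAT IS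
REPRODUCED: SKELETON rows **C1.Thm7.1.1** (*"There exists a constant c > 0, independent of k, such that c ≤ σ_k (7.1.1)"*, typed
`BIJ85Sect7Statements.Thm711`, p239582) and **C1.Prop7.1.2** (p. 324 [PDF 26]: *"Proof. It is sufficient to show that there is a
constant c > 0 such that c ≤ σ_k(p) (7.1.22) for all |p_j| ≤ π"*) of `HOME/lit-balaban-r15/ROWS-C1.md` (fold owner r15, referee
ref-5); kind «model-instance, boundary completion» of gen-3's `BIJ85Thm711Fibrewise.thm711_fibreModel` (p247834; momenta 0 < |p_i| ≤ π
only — GAPS.md G-C1-03), as needed by p27's Plancherel bridge `BIJ85Eq712Plancherel.thm711_of_realMomenta` (p248485: the fibrewise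
bound at ALL dual momenta |p_j| ≤ π, zero components included, is its hypothesis `hfib`).

WHAT IS KERNEL-CHECKED (zero `sorry`, axioms {propext, Classical.choice, Quot.sound}):
* **continuity**: p ↦ ⟨f, σ^C_k(p)f⟩ (file 1/3 `sigmaC`) is continuous on the regular set `regSet` = {Δ(p + l) ≠ 0 ∀l, φ_μ(p) > 0 ∀μ,
  N(p) = Σ_ρ|∂^{(1)}_ρ(p)|²/φ_ρ(p) > 0} (`continuousOn_sigmaC`, `continuousOn_form`; all ingredients are trigonometric polynomials,
  quotients by Δ(p + l), φ_μ, √(φ_νφ_κ), N, and (φ_νφ_κ)^{−1/2}), and the regular set contains every p ≠ 0 of the closed cube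
  (`mem_regSet`: Δ(p + l) ≥ |∂^{(1)}_ρ(p)|² > 0 for a component p_ρ ≠ 0; φ_μ(p) ≥ |u(p)v_μ(p)|²/Δ(p) > 0 by (7.1.20); N(p) > 0);
* **Theorem 7.1.1 / (7.1.22) on the closed cube**: `thm711_closedCube` — for every d ≥ 1, every gen-3 `Scale` (η = 1/n, |m_i| ≤ M,
  2M + 1 ≤ n), EVERY p with |p_i| ≤ π and every two-form f ∈ 𝒦(p): c(d)‖f‖² ≤ ⟨f, σ^C_k(p)f⟩ with gen-3's constant
  c(d) = ¼·min{1,(ε/2dc₂²)²}·ε, ε = ½(2/π)^{2d+4} (file 1/3 `c711`; depends on d only — *"independent of k"*).  Route: at generic p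
  (all p_i ≠ 0) it IS gen-3's `thm711_explicit` by file 1/3 `sigmaC_form_eq`; a momentum p ≠ 0 with vanishing components is the end
  point t = 0 of the path `fillPath p t` (zero components replaced by t ∈ (0, π]) of generic momenta along which the form is
  continuous, so the inequality passes to the limit (`ge_of_tendsto`); at p = 0 file 2/3 `half_normSq_le_sigmaC_zero` and c(d) ≤ ½;
* packaged in r15's shape: **`thm711_closedCube_family : Thm711 (fun k => sigmaFormClosed d (sc k))`** (carrier Σ_{|p_j| ≤ π} 𝒦(p);
  gen-3's `thm711_fibreModel` with the boundary momenta and the fibre p′ = 0 now INCLUDED), `thm711_closedCube_scaleOdd` (η = L^{−k}).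
NOT CLAIMED: the identification of σ^C_k(p) with the symbol of the configuration-space σ_k = Q^e_k(I − ∂G_{k,Ax}∂^*)Q^{e*}_k of
(4.2.2)/(7.1.12) (*"straightforward, algebraic manipulation"* from [6I] (1.83)–(1.84); seat p27's `BIJ85Eq712Plancherel` /
`BIJ85Eq712SymbolCalculus` lane); the continuity-and-density argument for the boundary momenta is ours (print treats |p_j| ≤ π
uniformly and does not discuss the removable singularities of (7.1.7)–(7.1.16)).  Unit `lit-balaban-p10` (gen 4), HOME as above.
-/

namespace Literature.MathematicalPhysics.QuantumFieldTheory.BalabanImbrieJaffe1984to88.BIJ85Thm711ClosedCube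

open scoped BigOperators Real ComplexConjugate Topology Matrix Kronecker
open Finset Filter Matrix
open Literature.MathematicalPhysics.QuantumFieldTheory.BalabanImbrieJaffe1984to88.BIJ85MomentumSymbols71
open Literature.MathematicalPhysics.QuantumFieldTheory.BalabanImbrieJaffe1984to88.BIJ85CurlComplement719
open Literature.MathematicalPhysics.QuantumFieldTheory.BalabanImbrieJaffe1984to88.BIJ85Tau0Positivity729
open Literature.MathematicalPhysics.QuantumFieldTheory.BalabanImbrieJaffe1984to88.BIJ85Tau2Kernel715
open Literature.MathematicalPhysics.QuantumFieldTheory.BalabanImbrieJaffe1984to88.BIJ85SigmaOnCurls325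
open Literature.MathematicalPhysics.QuantumFieldTheory.BalabanImbrieJaffe1984to88.BIJ85AveragingSums716
open Literature.MathematicalPhysics.QuantumFieldTheory.BalabanImbrieJaffe1984to88.BIJ85Prop712Fibre
open Literature.MathematicalPhysics.QuantumFieldTheory.BalabanImbrieJaffe1984to88.BIJ85Thm711Fibrewise
open Literature.MathematicalPhysics.QuantumFieldTheory.BalabanImbrieJaffe1984to88.BIJ85Sect7Statements
open Literature.MathematicalPhysics.QuantumFieldTheory.BalabanImbrieJaffe1984to88.BIJ85SigmaClosedCube
open Literature.MathematicalPhysics.QuantumFieldTheory.BalabanImbrieJaffe1984to88.BIJ85SigmaClosedCubeZero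

noncomputable section

variable {d : ℕ}

/-! ## §5 Continuity of the corrected σ_k(p) in p, away from the singular set -/

/-- kernel: p ↦ p + l is continuous. [folklore] -/
private theorem continuous_shiftMom (m : Fin d → ℤ) : Continuous fun p : Fin d → ℝ => shiftMom p m := by
  have : (fun p : Fin d → ℝ => shiftMom p m) = fun p => p + fun i => 2 * π * (m i : ℝ) := by
    funext p i; simp [shiftMom]
  rw [this]
  exact continuous_id.add continuous_const

/-- kernel: ∂_μ(q) is continuous in q. [folklore] -/
private theorem continuous_dSym (η : ℝ) (μ : Fin d) : Continuous fun q : Fin d → ℝ => dSym η q μ := by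
  unfold dSym
  refine Continuous.div_const ?_ _
  refine (Complex.continuous_exp.comp ?_).sub continuous_const
  exact continuous_const.mul (Complex.continuous_ofReal.comp (continuous_const.mul (continuous_apply μ)))

/-- kernel: ∂^{(1)}_μ(q) is continuous in q. [folklore] -/
private theorem continuous_dOne (μ : Fin d) : Continuous fun q : Fin d → ℝ => dOne q μ := by
  unfold dOne
  refine (Complex.continuous_exp.comp ?_).sub continuous_const
  exact continuous_const.mul (Complex.continuous_ofReal.comp (continuous_apply μ))

/-- kernel: Δ(q) is continuous in q. [folklore] -/
private theorem continuous_lapSym (η : ℝ) : Continuous fun q : Fin d → ℝ => lapSym η q := by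
  unfold lapSym
  exact continuous_finsetSum _ fun μ _ => ((continuous_dSym η μ).norm).pow 2

/-- kernel: u and the Q^e-weights are continuous (products of trigonometric polynomials). [folklore] -/
private theorem continuous_uC (n : ℕ) : Continuous fun q : Fin d → ℝ => uC n q := by
  unfold uC; exact continuous_finsetProd _ fun ρ _ => continuous_vC n ρ

/-- kernel: the Q^e-weights are continuous (products of trigonometric polynomials). [folklore] -/
private theorem continuous_qeW (n : ℕ) (μ ν : Fin d) : Continuous fun q : Fin d → ℝ => qeW n q μ ν := by
  unfold qeW; exact continuous_finsetProd _ fun ρ _ => continuous_vC n ρ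

/-- kernel: the bracket [δ − ∂∂̄/Δ](q) is continuous where Δ(q) ≠ 0. [folklore] -/
private theorem continuousOn_projSym (η : ℝ) (μ l : Fin d) :
    ContinuousOn (fun q : Fin d → ℝ => projSym η q μ l) {q | lapSym η q ≠ 0} := by
  unfold projSym
  refine continuousOn_const.sub (ContinuousOn.div ?_ ?_ ?_)
  · exact ((continuous_dSym η μ).mul (Complex.continuous_conj.comp (continuous_dSym η l))).continuousOn
  · exact (Complex.continuous_ofReal.comp (continuous_lapSym η)).continuousOn
  · intro q hq; exact_mod_cast hq

/-- kernel: the shifted l-term is continuous in p where Δ(p + l) ≠ 0. [folklore] -/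
private theorem continuousOn_t1C_shift (n : ℕ) (m : Fin d → ℤ) (μ ν l κ : Fin d) :
    ContinuousOn (fun p : Fin d → ℝ => t1C n (shiftMom p m) μ ν l κ)
      {p | lapSym ((n : ℝ)⁻¹) (shiftMom p m) ≠ 0} := by
  have hP : ∀ a b : Fin d, ContinuousOn (fun p : Fin d → ℝ => projSym ((n : ℝ)⁻¹) (shiftMom p m) a b)
      {p | lapSym ((n : ℝ)⁻¹) (shiftMom p m) ≠ 0} := fun a b =>
    (continuousOn_projSym _ a b).comp (continuous_shiftMom m).continuousOn fun p hp => hp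
  unfold t1C
  refine ContinuousOn.mul (ContinuousOn.mul ?_ ?_) ((hP μ l).mul (hP ν κ))
  · exact (Complex.continuous_conj.comp ((continuous_qeW n μ ν).comp (continuous_shiftMom m))).continuousOn
  · exact ((continuous_qeW n l κ).comp (continuous_shiftMom m)).continuousOn

/-- kernel: τ₁(p′) entries are continuous on the regular set. [folklore] -/
private theorem continuousOn_tau1C (n M : ℕ) (μ ν l κ : Fin d) :
    ContinuousOn (fun p : Fin d → ℝ => tau1C n M p μ ν l κ) (regSet (d := d) n M) := by
  unfold tau1C
  refine continuousOn_const.mul (continuousOn_finsetSum _ fun m hm => ?_)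
  exact (continuousOn_t1C_shift n m μ ν l κ).mono fun p hp => hp.1 m hm

/-- kernel: a_μ(p′) is continuous on the regular set. [folklore] -/
private theorem continuousOn_aC (n M : ℕ) (μ : Fin d) :
    ContinuousOn (fun p : Fin d → ℝ => aC n M p μ) (regSet (d := d) n M) := by
  unfold aC
  refine (continuous_dOne μ).continuousOn.mul (Complex.continuous_ofReal.comp_continuousOn ?_)
  refine continuousOn_finsetSum _ fun m hm => ?_
  unfold aTermC
  refine ContinuousOn.mul ?_ ?_
  · exact (continuous_finsetProd _ fun ρ _ => (((continuous_vC n ρ).comp (continuous_shiftMom m)).norm).pow 2).continuousOn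
  · exact ((continuous_lapSym _).comp (continuous_shiftMom m)).continuousOn.inv₀ fun p hp => hp.1 m hm

/-- kernel: φ_μ(p′) is continuous on the regular set. [folklore] -/
private theorem continuousOn_phiC (n M : ℕ) (μ : Fin d) :
    ContinuousOn (fun p : Fin d → ℝ => phiC n M p μ) (regSet (d := d) n M) := by
  unfold phiC
  refine continuousOn_finsetSum _ fun m hm => ContinuousOn.mul ?_ ?_
  · exact ((((continuous_uC n).comp (continuous_shiftMom m)).mul
      ((continuous_vC n μ).comp (continuous_shiftMom m))).norm.pow 2).continuousOn
  · exact ((continuous_lapSym _).comp (continuous_shiftMom m)).continuousOn.inv₀ fun p hp => hp.1 m hm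

/-- kernel: τ₂(p′) entries are continuous on the regular set. [folklore] -/
private theorem continuousOn_tau2C (n M : ℕ) (μ ν l κ : Fin d) :
    ContinuousOn (fun p : Fin d → ℝ => tau2C n M p μ ν l κ) (regSet (d := d) n M) := by
  have ha := continuousOn_aC (d := d) n M
  have hφ := continuousOn_phiC (d := d) n M
  have he : ∀ ρ, Continuous fun p : Fin d → ℝ => dOne p ρ := continuous_dOne
  have hprod : ContinuousOn (fun p : Fin d → ℝ => phiC n M p ν * phiC n M p κ) (regSet n M) := (hφ ν).mul (hφ κ)
  have hprod_pos : ∀ p ∈ regSet (d := d) n M, 0 < phiC n M p ν * phiC n M p κ := fun p hp => mul_pos (hp.2.1 ν) (hp.2.1 κ)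
  have hN : ContinuousOn (fun p : Fin d → ℝ => ∑ ρ : Fin d, ‖dOne p ρ‖ ^ 2 / phiC n M p ρ) (regSet n M) :=
    continuousOn_finsetSum _ fun ρ _ => ((he ρ).norm.pow 2).continuousOn.div (hφ ρ) fun p hp => (hp.2.1 ρ).ne'
  unfold tau2C tau2Kernel
  refine ContinuousOn.mul (ContinuousOn.mul ((ha μ).mul (Complex.continuous_conj.comp_continuousOn (ha l))) ?_) ?_
  · exact Complex.continuous_ofReal.comp_continuousOn (hprod.rpow_const fun p hp => Or.inl (hprod_pos p hp).ne')
  · refine continuousOn_const.sub (ContinuousOn.mul (ContinuousOn.div ?_ ?_ ?_) ?_)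
    · exact ((he ν).mul (Complex.continuous_conj.comp (he κ))).continuousOn
    · exact Complex.continuous_ofReal.comp_continuousOn hprod.sqrt
    · intro p hp
      exact_mod_cast (Real.sqrt_pos.mpr (hprod_pos p hp)).ne'
    · refine (Complex.continuous_ofReal.comp_continuousOn hN).inv₀ fun p hp => ?_
      have : 0 < ∑ ρ : Fin d, ‖dOne p ρ‖ ^ 2 / phiC n M p ρ := hp.2.2
      rw [Function.comp_apply]
      exact_mod_cast this.ne'

/-- **σ_k(p) (corrected) is continuous in p on the regular set**, entrywise. [cite: BalabanImbrieJaffe1985, (7.1.13) p.322] -/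
theorem continuousOn_sigmaC (n M : ℕ) (μ ν l κ : Fin d) :
    ContinuousOn (fun p : Fin d → ℝ => sigmaC n M p μ ν l κ) (regSet (d := d) n M) :=
  (continuousOn_tau1C n M μ ν l κ).add (continuousOn_tau2C n M μ ν l κ)

/-- … hence so is the quadratic form p ↦ ⟨f, σ_k(p)f⟩ for every fixed f. [cite: BalabanImbrieJaffe1985, (7.1.3) p.321] -/
theorem continuousOn_form (n M : ℕ) (f : Fin d → Fin d → ℂ) :
    ContinuousOn (fun p : Fin d → ℝ => (tensorInner f (sigmaC n M p) f).re) (regSet (d := d) n M) := by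
  refine Complex.continuous_re.comp_continuousOn ?_
  unfold tensorInner
  refine continuousOn_finsetSum _ fun μ _ => continuousOn_finsetSum _ fun ν _ => continuousOn_finsetSum _ fun l _ =>
    continuousOn_finsetSum _ fun κ _ => ?_
  exact (continuousOn_const.mul (continuousOn_sigmaC n M μ ν l κ)).mul continuousOn_const

/-- **The punctured closed cube lies in the regular set**: for p ≠ 0 with |p_i| ≤ π (η = 1/n, n ≥ 1) every Δ(p + l) > 0,
every φ_μ(p) > 0 (its l = 0 term is |u(p)v_μ(p)|²/Δ(p) > 0 by (7.1.20)) and N(p) > 0. [cite: BalabanImbrieJaffe1985, (7.1.20) p.323] -/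
theorem mem_regSet {n : ℕ} (hn : 0 < n) (M : ℕ) {p : Fin d → ℝ} (hp : ∀ i, |p i| ≤ π) (hp0 : p ≠ 0) :
    p ∈ regSet (d := d) n M := by
  have hΔ : ∀ m : Fin d → ℤ, 0 < lapSym ((n : ℝ)⁻¹) (shiftMom p m) := lapSym_shift_pos_of_ne_zero hn hp hp0
  have hΔ0 : 0 < lapSym ((n : ℝ)⁻¹) p := by simpa only [shiftMom_zero] using hΔ 0
  have hφ : ∀ μ, 0 < phiC n M p μ := by
    intro μ
    have hterm : ∀ m ∈ lShifts d M,
        0 ≤ ‖uC n (shiftMom p m) * vC n (shiftMom p m) μ‖ ^ 2 * (lapSym ((n : ℝ)⁻¹) (shiftMom p m))⁻¹ :=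
      fun m _ => mul_nonneg (sq_nonneg _) (inv_nonneg.mpr (hΔ m).le)
    have h0 : 0 < ‖uC n (shiftMom p 0) * vC n (shiftMom p 0) μ‖ ^ 2 * (lapSym ((n : ℝ)⁻¹) (shiftMom p 0))⁻¹ := by
      rw [shiftMom_zero]
      refine mul_pos (pow_pos (norm_pos_iff.mpr (mul_ne_zero ?_ (vC_ne_zero hn (hp μ)))) 2) (inv_pos.mpr hΔ0)
      exact Finset.prod_ne_zero_iff.mpr fun ρ _ => vC_ne_zero hn (hp ρ)
    exact lt_of_lt_of_le h0 (Finset.single_le_sum hterm (zero_mem_lShifts d M))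
  refine ⟨fun m _ => (hΔ m).ne', hφ, ?_⟩
  obtain ⟨ρ, hρ⟩ := Function.ne_iff.mp hp0
  have h1 : dOne p ρ ≠ 0 := fun h => hρ ((dOne_eq_zero_iff_of_abs_le (hp ρ)).mp h)
  unfold enn
  exact lt_of_lt_of_le (div_pos (pow_pos (norm_pos_iff.mpr h1) 2) (hφ ρ))
    (Finset.single_le_sum (f := fun ρ => ‖dOne p ρ‖ ^ 2 / phiC n M p ρ) (fun ρ _ => div_nonneg (sq_nonneg _) (hφ ρ).le)
      (Finset.mem_univ ρ))

/-! ## §6 Theorem 7.1.1 / (7.1.22) on the CLOSED momentum cube -/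

/-- kernel: at t = 0 the path sits at p. [folklore] -/
private theorem fillPath_zero (p : Fin d → ℝ) : fillPath p 0 = p := by
  funext i
  by_cases h : p i = 0 <;> simp [fillPath, h]

/-- kernel: the path is continuous in t. [folklore] -/
private theorem continuous_fillPath (p : Fin d → ℝ) : Continuous (fillPath p) :=
  continuous_pi fun i => by
    by_cases h : p i = 0
    · simp only [fillPath, h, if_true]; exact continuous_id
    · simp only [fillPath, h, if_false]; exact continuous_const

/-- kernel: for 0 < t ≤ π the path runs through momenta with all components nonzero inside the closed cube. [folklore] -/
private theorem fillPath_generic {p : Fin d → ℝ} (hp : ∀ i, |p i| ≤ π) {t : ℝ} (ht0 : 0 < t) (htπ : t ≤ π) (i : Fin d) :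
    fillPath p t i ≠ 0 ∧ |fillPath p t i| ≤ π := by
  by_cases h : p i = 0
  · simp only [fillPath, h, if_true]
    exact ⟨ht0.ne', by rw [abs_of_pos ht0]; exact htπ⟩
  · simp only [fillPath, h, if_false]
    exact ⟨h, hp i⟩

/-- kernel: for 0 ≤ t ≤ π and p ≠ 0 the path stays in the punctured closed cube. [folklore] -/
private theorem fillPath_mem {p : Fin d → ℝ} (hp : ∀ i, |p i| ≤ π) (hp0 : p ≠ 0) {t : ℝ} (ht0 : 0 ≤ t) (htπ : t ≤ π) :
    (∀ i, |fillPath p t i| ≤ π) ∧ fillPath p t ≠ 0 := by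
  constructor
  · intro i
    by_cases h : p i = 0
    · simp only [fillPath, h, if_true]; rw [abs_of_nonneg ht0]; exact htπ
    · simp only [fillPath, h, if_false]; exact hp i
  · obtain ⟨ρ, hρ⟩ := Function.ne_iff.mp hp0
    have hρ' : p ρ ≠ 0 := hρ
    refine Function.ne_iff.mpr ⟨ρ, ?_⟩
    show fillPath p t ρ ≠ 0
    rw [fillPath, if_neg hρ']
    exact hρ'

/-- **Theorem 7.1.1 in the fibrewise form (7.1.22) on the CLOSED cube** — p. 324 *"it is sufficient to show that there is a constant
c > 0 such that c ≤ σ_k(p) (7.1.22) for all |p_j| ≤ π"*: for EVERY momentum with |p_j| ≤ π (components may vanish; p′ = 0 included),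
every scale (η = 1/n, l-range |m_i| ≤ M, 2M + 1 ≤ n — gen-3 `Scale`) and every two-form f ∈ 𝒦(p): c(d)‖f‖² ≤ ⟨f, σ_k(p)f⟩ for
the symbols (7.1.13)–(7.1.16) with their removable singularities filled (`sigmaC`), c(d) = `c711 d` as in gen-3 `thm711_explicit`.
Proof: at generic p this IS `thm711_explicit` (`sigmaC_form_eq`); a momentum p ≠ 0 with vanishing components is the end point
t = 0 of the path `fillPath p t` of generic momenta, along which the form is continuous (`continuousOn_form`, `mem_regSet`), so the
inequality passes to the limit; at p = 0 `half_normSq_le_sigmaC_zero` and c(d) ≤ ½. [cite: BalabanImbrieJaffe1985, Prop. 7.1.2 (7.1.22) p.324] -/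
theorem thm711_closedCube (hd : 0 < d) (s : Scale) (p : Fin d → ℝ) (hp : ∀ i, |p i| ≤ π) (f : TwoForm d) :
    c711 d * normSq f.1 ≤ (tensorInner f.1 (sigmaC s.n s.M p) f.1).re := by
  obtain ⟨hn, -, -⟩ := s.pos
  by_cases hp0 : p = 0
  · subst hp0
    have h := half_normSq_le_sigmaC_zero (d := d) hn s.M f.1
    have hc := c711_le_half d
    have hN : 0 ≤ normSq f.1 := Finset.sum_nonneg fun _ _ => Finset.sum_nonneg fun _ _ => sq_nonneg _
    nlinarith
  · -- the limiting argument along `fillPath p`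
    set g : ℝ → ℝ := fun t => (tensorInner f.1 (sigmaC s.n s.M (fillPath p t)) f.1).re with hg
    have hmaps : Set.MapsTo (fillPath p) (Set.Icc 0 π) (regSet (d := d) s.n s.M) := fun t ht =>
      mem_regSet hn s.M (fillPath_mem hp hp0 ht.1 ht.2).1 (fillPath_mem hp hp0 ht.1 ht.2).2
    have hcont : ContinuousOn g (Set.Icc 0 π) :=
      (continuousOn_form s.n s.M f.1).comp (continuous_fillPath p).continuousOn hmaps
    have hge : ∀ t ∈ Set.Ioc (0 : ℝ) π, c711 d * normSq f.1 ≤ g t := by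
      intro t ht
      have hgen : ∀ i, fillPath p t i ≠ 0 ∧ |fillPath p t i| ≤ π := fillPath_generic hp ht.1 ht.2
      have h := thm711_explicit hd (fun _ => s) 0 ⟨fillPath p t, hgen⟩ f
      have hform := congrArg Complex.re (sigmaC_form_eq hn s.M hgen f.2)
      rw [hg]
      dsimp only
      rw [hform]
      exact h
    have htend : Tendsto g (𝓝[Set.Ioc 0 π] 0) (𝓝 (g 0)) :=
      ((hcont 0 ⟨le_rfl, Real.pi_pos.le⟩).mono Set.Ioc_subset_Icc_self).tendsto
    haveI : (𝓝[Set.Ioc (0 : ℝ) π] 0).NeBot := left_nhdsWithin_Ioc_neBot Real.pi_pos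
    have hlim := ge_of_tendsto htend (eventually_nhdsWithin_of_forall hge)
    rw [hg] at hlim
    dsimp only at hlim
    rwa [fillPath_zero] at hlim

/-- **Theorem 7.1.1** (r15's `BIJ85Sect7Statements.Thm711`) **for the closed-cube fibre family**: ∃ c > 0 ∀ k ∀ p (|p_j| ≤ π) ∀ f ∈ 𝒦(p),
c‖f‖² ≤ ⟨f, σ_k(p)f⟩ — gen-3's `thm711_fibreModel` with the boundary momenta and the fibre p′ = 0 now INCLUDED; c = c(d).
NOT CLAIMED here: the identification of σ_k(p) with the symbol of the configuration-space σ_k of (4.2.2)/(7.1.12) (p27's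
`BIJ85Eq712Plancherel.thm711_of_realMomenta` takes exactly the present conclusion as its hypothesis `hfib`).
[cite: BalabanImbrieJaffe1985, Thm. 7.1.1 p.321] -/
theorem thm711_closedCube_family (hd : 0 < d) (sc : ℕ → Scale) : Thm711 fun k => sigmaFormClosed d (sc k) :=
  ⟨c711 d, c711_pos hd, fun k x => thm711_closedCube hd (sc k) x.1.1 x.1.2 x.2⟩

/-- The closed-cube bound for a two-form given as a bare array with its antisymmetry hypothesis (the shape a consumer of the
fibrewise bound at all |p_j| ≤ π — e.g. p27's `thm711_of_realMomenta` — instantiates). [cite: BalabanImbrieJaffe1985, Prop. 7.1.2 (7.1.22) p.324] -/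
theorem thm711_closedCube' (hd : 0 < d) (s : Scale) (p : Fin d → ℝ) (hp : ∀ i, |p i| ≤ π) {f : Fin d → Fin d → ℂ}
    (hf : IsTwoForm f) : c711 d * normSq f ≤ (tensorInner f (sigmaC s.n s.M p) f).re :=
  thm711_closedCube hd s p hp ⟨f, hf⟩

/-- ⟨f, σ^C_k(p)f⟩ is a REAL number at every p (τ₁: sum of squared norms; τ₂: a Hermitian kernel), so the real parts above
discard nothing. [cite: BalabanImbrieJaffe1985, (7.1.13) p.322] -/
theorem sigmaC_form_im (n M : ℕ) (p : Fin d → ℝ) (f : Fin d → Fin d → ℂ) : (tensorInner f (sigmaC n M p) f).im = 0 := by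
  have h1 : (tensorInner f (tau1C n M p) f).im = 0 := (half_term_le_tau1C n M p f (zero_mem_lShifts d M)).2
  have h2 : (tensorInner f (tau2C n M p) f).im = 0 := by
    have hT : ∀ μ ν l κ, conj (tau2C n M p μ ν l κ) = tau2C n M p l κ μ ν := fun μ ν l κ => by
      rw [tau2C, tau2Kernel_conj_symm]
    exact Complex.conj_eq_iff_im.mp (tensorInner_conj_symm hT f f)
  unfold sigmaC
  rw [tensorInner_add_kernel, Complex.add_im, h1, h2, add_zero]

/-- The same for the printed scales η = L^{−k}, |m_i| ≤ (L^k − 1)/2 (gen-3 `scaleOdd`; any L ≥ 1, d ≥ 1).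
[cite: BalabanImbrieJaffe1985, Thm. 7.1.1 p.321] -/
theorem thm711_closedCube_scaleOdd (hd : 0 < d) {L : ℕ} (hL : 1 ≤ L) :
    Thm711 fun k => sigmaFormClosed d (scaleOdd L hL k) :=
  thm711_closedCube_family hd (scaleOdd L hL)

end

end Literature.MathematicalPhysics.QuantumFieldTheory.BalabanImbrieJaffe1984to88.BIJ85Thm711ClosedCube
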